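import Literature.Geometry.Kaehler.ComplexTorusAbelianGroupAction
import HarnessLib

/-!
# Roan's decomposition theorem for an automorphism of finite order of a complex torus, as printed
# (the recursive filtration `Y_{d_i}`, the parts `B_{d_i} = Ker((1 - α^{d_i})|Y_{d_{i-1}})_0`), and
# Theorem 3.1 of Carocca–Lange–Rodríguez: `B_{d_i} = A_{W_{d_i}} = X^{e_{d_i}}`

Layer `Literature/Geometry/Kaehler`, namespace `Literature.Geometry.Kaehler.ComplexTorus` (polynomial algebra in
`Literature.Geometry.Kaehler.CyclotomicIdempotents`); lane `lit-hodgefound`, Layer A2, row «A2-26(z)» (self-proposed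
2026-08-22, seat `lit-hodgefound-p10`, generation 9).  Sequel of `ComplexTorusCyclicGroupAction.lean` (generation 7:
the cyclotomic idempotents `e_d(u) = cyclicIdempotent n u d = E_{n,d}(u)` of an endomorphism `u ∈ End_ℚ(X)` with
`uⁿ = 1`, `X^{e_d} = idemSubspace`, `isIsogeny_sum_cyclicIdempotent`) and of `ComplexTorusAbelianGroupAction.lean`
§6 (generation 9: `e_{⟨g^d⟩} = e_d(ρ g)` for a cyclic group, Lemma 3.2 in lattice form).  Those files prove the
ISOTYPICAL side of Theorem 3.1; this file formalizes ROAN'S side — the filtration and the parts exactly as printed —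
and proves that the two agree.

## Source, verbatim

A. Carocca, H. Lange, R. E. Rodríguez, *Abelian varieties with finite abelian group action*, Arch. Math. **112**
(2019) 615–622 (= arXiv 1904.02764; held text `paper:arxiv-1904.02764`, p0004–p0005):

> (§2.2 Roan's decomposition theorem) "Now let `G` be a cyclic group of order `d` acting on an abelian variety
> `A`, generated by an automorphism `α`. Suppose `1 ≤ d_1 < d_2 < ⋯ < d_s` are the orders of the eigenvalues
> of `α`, meaning the eigenvalues of the analytic representation `ρ_a(α)` of `α`. Define a filtration of `A`
> into `G`-stable abelian subvarieties `0 = Y_{d_s} ⊂ Y_{d_{s-1}} ⊂ ⋯ ⊂ Y_{d_1} ⊂ Y_{d_0} = A` by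
> `Y_{d_0} := A` and `Y_{d_i} := Im(1_A - α^{d_i})|Y_{d_{i-1}}` for `i ≥ 1`, where `|` means restricted. Then
> denote for `i = 1, …, s`, `B_{d_i} := ker((1_A - α^{d_i})|Y_{d_{i-1}})_0` where the index `0` stands for the
> connected component of the kernel containing `0`. […] Clearly the `B_{d_i}` are `G`-stable abelian
> subvarieties of `A` such that `α_i := α|B_{d_i}` is an automorphism of order `d_i` for all `i`. […] Then
> Roan's decomposition theorem says (see [lb]) that the addition map `B_{d_1} × ⋯ × B_{d_s} → A` is an
> isogeny. Note that all subvarieties `B_{d_i}` are of positive dimension, whereas for the isotypical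
> decomposition this need not be the case."
> (§3) "**Theorem 3.1.** The decompositions (2.1) and (2.2) are the same in the following sense: (i) For every
> `i = 1, …, s` there is exactly one `j_i ∈ {1, …, r}` such that `A_{W_{j_i}} = B_{d_i}` and the `j_i`'s are
> pairwise different. (ii) For all components `A_{W_k}` with `k ≠ j_i` for `i = 1, …, s` we have `A_{W_k} = 0`."

## What is proved, and in which form (lattice level; definitions with bodies, theorems; NO named fact)

`X = (Λ ⊗ ℝ)/Λ` is a complex torus given by a period isomorphism `Φ`, `u ∈ End_ℚ(X) = endAlgRat Φ` with
`uⁿ = 1` (e.g. the rational representation of an automorphism `α` of finite order, or `ρ(g)` for a generator of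
a cyclic group acting on `X`), `U = (u : Matrix ι ι ℚ)`.  Sub-tori are handled through their real subspaces
`⊆ Λ ⊗ ℝ = ι → ℝ` (the "connected component containing `0`" of a closed subgroup is the sub-torus on the real
subspace; images and kernels of endomorphisms are taken on `Λ ⊗ ℝ`).

* §1 polynomial algebra (`CyclotomicIdempotents`): `isCoprime_cyclotomic_one_sub_X_pow` (`Φ_d ⊥ 1 - x^m` for
  `d ∤ m`), Roan's polynomial **`roanPoly l = ∏_{m ∈ l} (1 - x^m)`** (`roanPoly_eq_prod`, `_cons`,
  `_append_singleton`), `X_pow_sub_one_dvd_roanPoly_mul_cycIdem` (`R_l E_{n,m} ≡ 0` for `m ∈ l`),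
  `exists_cyclotomic_dvd_roanPoly_mul_sub_one` (`R_l` invertible mod `Φ_d` if `d ∤ m ∀ m ∈ l`),
  **`exists_X_pow_sub_one_dvd_roanPoly_mul_sub_cycIdem`** (`E_{n,d} ≡ R_l Q`),
  `exists_X_pow_sub_one_dvd_cycIdem_mul_one_sub_X_pow_sub` (`E_{n,m} ≡ E_{n,m} b (1 - x^d)` for `m ∤ d`).
* §2 ROAN'S OBJECTS AS PRINTED, for any rational matrix `U`: **`roanY U l`** (the left fold
  `Y_{[]} = ⊤`, `Y_{l ++ [d]} = (1 - U^d)(Y_l)`: `roanY_nil`, `roanY_append_singleton`), **`roanB U l d =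
  Ker(1 - U^d) ⊓ Y_l`** (`mem_roanB_iff`: `U^d v = v ∧ v ∈ Y_l`), `roanY_eq_idemSubspace_foldl` (`Y_l = Im R_l(U)`,
  with the private plumbing `map_mulVecLin_idemSubspace`, `idemSubspace_mul_le`), `roanY_append_singleton_le`
  (the filtration decreases), `mulVec_mem_roanY` / `mulVec_mem_roanB` (`G`-stable).
* §3 for `u ∈ End_ℚ(X)`, `uⁿ = 1`: `roanY_eq_idemSubspace` (`Y_l = X^{R_l(u)}`),
  `idemSubspace_cyclicIdempotent_le_ker` (`X^{e_d} ⊆ Ker(1 - u^d)`), `idemSubspace_cyclicIdempotent_le_roanY`,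
  `cyclicIdempotent_mulVec_eq_zero_of_not_dvd` / `_of_mem`, and the main identification
  **`roanB_eq_idemSubspace_cyclicIdempotent`: `Ker(1 - u^d) ∩ Y_l = X^{e_d(u)}`** whenever every `m ∈ l` is
  positive with `d ∤ m` and `l` contains every proper divisor `m` of `d` with `X^{e_m} ≠ 0`.
* §4 **`eigenvalueOrders n u = {d ∣ n : e_d(u) ≠ 0}`** (`mem_eigenvalueOrders_iff_ne_bot`: iff `X^{e_d} ≠ 0`),
  Roan's sorted list **`roanList n u = [d_1 < ⋯ < d_s]`** (`mem_roanList`, `roanList_pairwise_lt`), and ROAN'S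
  THEOREM / THEOREM 3.1: **`roanB_roanList_take_eq`** (`B_{d_i} := Ker((1 - u^{d_i})|Y_{d_{i-1}}) = X^{e_{d_i}}`
  for every `i`), `roanB_roanList_filter_eq` (same with the prefix written `{d_j < d}`, any `d ≥ 1` — for `d`
  not an eigenvalue order both sides are `0`, Thm. 3.1 (ii)), **`roanY_roanList_eq_bot`** (`Y_{d_s} = 0`),
  **`roanB_roanList_take_ne_bot`** (every `B_{d_i}` has positive dimension),
  `completeOrthogonalIdempotents_eigenvalueOrders`, **`isIsogeny_sum_roan`** (the addition map
  `∏_{d ∈ {d_i}} X^{e_d} → X` is an isogeny — Roan's `B_{d_1} × ⋯ × B_{d_s} → A`, the factors being the tori on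
  Roan's subspaces by `roanB_roanList_take_eq`), `isIsogenous_sigmaPi_roan`.
* §5 junction with the group algebra: for a cyclic `G = ⟨g⟩` of order `n` acting by `ρ`,
  **`roanB_eq_idemSubspace_kernelIdempotent_zpowers_pow`**: Roan's `B_d` for `u = ρ(g)` is the isotypical
  component `X^{ρ̄ e_{⟨g^d⟩}}` of `ComplexTorusAbelianGroupAction` (Theorem 3.1 (i) literally: `A_{W_{j_i}} = B_{d_i}`
  with `W_{j_i}` the rational irreducible representation of kernel `⟨g^{d_i}⟩`).
* §6 (rider) validation: `roanB_nil_one` (`B_1 = Fix(u) = X^{e_1}`), `roanB_singleton_one_two`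
  (`B_2 = Ker(1 - u²) ∩ Im(1 - u) = X^{e_2}`), involutions `roanB_nil_one_of_involution` /
  `roanB_singleton_one_two_of_involution` (Q490's symmetric / anti-symmetric pair), `roanList_neg_one = [2]`,
  `roanB_neg_one_two = ⊤`, the swap of `X × X`: `roanB_swapEnd_one = Δ`, `roanB_swapEnd_two = Δ⁻`.

Not here: the identification of `eigenvalueOrders` with the orders of the eigenvalues of the ANALYTIC
representation is through `ComplexTorusCyclicGroupAction` (`charpoly_restrictEnd_cyclicIdempotent`:
`charpoly(u|X^{e_d}) = Φ_d^{h_d}`, and `Σ_d rk Λ(X^{e_d}) = rk Λ`), i.e. through the RATIONAL representation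
`ρ_r = ρ_a ⊕ ρ̄_a`, which has the same eigenvalue orders.

## References

* [CaroccaLangeRodriguez2019] A. Carocca, H. Lange, R. E. Rodríguez, *Abelian varieties with finite abelian group
  action*, Arch. Math. 112 (2019) 615–622 — §2.2 (Roan's decomposition theorem), §3 Thm. 3.1, Lemma 3.2 (held
  `paper:arxiv-1904.02764`, p0004–p0005); the paper's reference for Roan's theorem is [lb] = Ch. Birkenhake,
  H. Lange, *Complex Abelian Varieties*, 2nd ed., Grundlehren 302 (2004).
* [LangeRodriguez2022] H. Lange, R. E. Rodríguez, *Decomposition of Jacobians by Prym Varieties*, LNM 2310 (2022),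
  §2.8 (2.22)–(2.23), §6.1.1 Prop. 6.1.2 (held, p0040, p0153).

## Mathlib / tree

`Polynomial.cyclotomic.isCoprime_rat`, `prod_cyclotomic_eq_X_pow_sub_one`, `IsCoprime.prod_right`, `List.foldl`,
`List.reverseRecOn`, `List.Pairwise`, `Finset.sort` / `Finset.sortedLT_sort`; tree: `cycIdem`, `cyclicIdempotent`,
`X_pow_sub_one_dvd_sub_cycIdem`, `aeval_eq_of_dvd_sub`, `sum_cyclicIdempotent`, `idemSubspace`,
`isIsogeny_sum_idem`, `groupAlgebraRep_kernelIdempotent_zpowers_pow`.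
-/

noncomputable section

open Module Submodule Matrix Polynomial
open scoped BigOperators

namespace Literature.Geometry.Kaehler

namespace CyclotomicIdempotents

variable {n : ℕ}

/-! ### §1 Polynomial algebra: `Φ_d` is prime to `1 - x^m` for `d ∤ m`; the products `R_l = ∏_{m ∈ l} (1 - x^m)` -/

/-- **`Φ_d` and `1 - x^m` are coprime when `d ∤ m`, `m ≥ 1`** (`x^m - 1 = ∏_{i ∣ m} Φ_i` and the cyclotomic
polynomials over `ℚ` are pairwise coprime). [cite: CaroccaLangeRodriguez2019, §3 (proof of Thm. 3.1: the eigenvalues of `α|B_{d_i}` "are exactly all eigenvalues of order `d_i`"), p0005] -/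
theorem isCoprime_cyclotomic_one_sub_X_pow {d m : ℕ} (hm : 0 < m) (hdm : ¬d ∣ m) :
    IsCoprime (cyclotomic d ℚ) (1 - X ^ m : ℚ[X]) := by
  have h : IsCoprime (cyclotomic d ℚ) (X ^ m - 1 : ℚ[X]) := by
    rw [← prod_cyclotomic_eq_X_pow_sub_one hm ℚ]
    refine IsCoprime.prod_right fun i hi ↦ cyclotomic.isCoprime_rat ?_
    rintro rfl
    exact hdm (Nat.dvd_of_mem_divisors hi)
  have hneg : (1 - X ^ m : ℚ[X]) = -(X ^ m - 1) := by ring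
  rw [hneg]
  exact h.neg_right

/-- **Roan's polynomial `R_l := (1 - x^{d_k}) ⋯ (1 - x^{d_1})` of a list `l = [d_1, …, d_k]`** (so that
`R_l(α) (A) = Im(1 - α^{d_k})|…|Im(1 - α^{d_1}) = Y_{d_k}`), built by the same left fold as the filtration.
[cite: CaroccaLangeRodriguez2019, §2.2 (`Y_{d_i} := Im(1_A - α^{d_i})|Y_{d_{i-1}}`), p0004] -/
def roanPoly (l : List ℕ) : ℚ[X] := l.foldl (fun P m ↦ (1 - X ^ m) * P) 1

/-- `R_{[]} = 1`. [folklore] -/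
@[simp] private theorem roanPoly_nil₉ : roanPoly [] = 1 := rfl

/-- The left fold is the product (commutativity of `ℚ[x]`). [folklore] -/
private theorem foldl_eq_prod_mul₉ (l : List ℕ) (P : ℚ[X]) :
    l.foldl (fun P m ↦ (1 - X ^ m) * P) P = (l.map fun m ↦ (1 - X ^ m : ℚ[X])).prod * P := by
  induction l generalizing P with
  | nil => rw [List.foldl_nil, List.map_nil, List.prod_nil, one_mul]
  | cons m l ih => rw [List.foldl_cons, ih, List.map_cons, List.prod_cons]; ring

/-- `R_l = ∏_{m ∈ l} (1 - x^m)`. [cite: CaroccaLangeRodriguez2019, §2.2, p0004] -/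
theorem roanPoly_eq_prod (l : List ℕ) : roanPoly l = (l.map fun m ↦ (1 - X ^ m : ℚ[X])).prod := by
  rw [roanPoly, foldl_eq_prod_mul₉, mul_one]

/-- `R_{m :: l} = (1 - x^m) R_l`. [cite: CaroccaLangeRodriguez2019, §2.2, p0004] -/
theorem roanPoly_cons (m : ℕ) (l : List ℕ) : roanPoly (m :: l) = (1 - X ^ m) * roanPoly l := by
  rw [roanPoly_eq_prod, roanPoly_eq_prod, List.map_cons, List.prod_cons]

/-- `R_{l ++ [m]} = (1 - x^m) R_l`. [cite: CaroccaLangeRodriguez2019, §2.2, p0004] -/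
theorem roanPoly_append_singleton (l : List ℕ) (m : ℕ) : roanPoly (l ++ [m]) = (1 - X ^ m) * roanPoly l := by
  rw [roanPoly_eq_prod, roanPoly_eq_prod, List.map_append, List.prod_append, List.map_singleton,
    List.prod_singleton, mul_comm]

/-- `(1 - x^m) ∣ R_l` for `m ∈ l`. [cite: CaroccaLangeRodriguez2019, §2.2, p0004] -/
theorem one_sub_X_pow_dvd_roanPoly {l : List ℕ} {m : ℕ} (hm : m ∈ l) : (1 - X ^ m : ℚ[X]) ∣ roanPoly l := by
  rw [roanPoly_eq_prod]
  exact List.dvd_prod (List.mem_map.2 ⟨m, hm, rfl⟩)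

/-- `Φ_m ∣ 1 - x^m`. [folklore] -/
private theorem cyclotomic_dvd_one_sub_X_pow₉ (m : ℕ) : cyclotomic m ℚ ∣ (1 - X ^ m : ℚ[X]) := by
  have hneg : (1 - X ^ m : ℚ[X]) = -(X ^ m - 1) := by ring
  rw [hneg, dvd_neg]
  exact cyclotomic.dvd_X_pow_sub_one m ℚ

/-- **`R_l E_{n,m} ≡ 0 (mod xⁿ - 1)` for `m ∈ l`**: the factor `(1 - x^m)` of `R_l` kills the `Φ_m`-component.
[cite: CaroccaLangeRodriguez2019, §2.2–§3 (`B_{d_i} ⊂ Ker(1 - α^{d_i})`), p0004–p0005] -/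
theorem X_pow_sub_one_dvd_roanPoly_mul_cycIdem (hn : 0 < n) {l : List ℕ} {m : ℕ} (hm : m ∈ l) :
    X ^ n - 1 ∣ roanPoly l * cycIdem n m := by
  refine X_pow_sub_one_dvd_of_forall hn fun m' hm' ↦ ?_
  by_cases h : m' = m
  · subst h
    exact dvd_mul_of_dvd_left ((cyclotomic_dvd_one_sub_X_pow₉ m').trans (one_sub_X_pow_dvd_roanPoly hm)) _
  · exact dvd_mul_of_dvd_right (cyclotomic_dvd_cycIdem hm' h) _

/-- `(1 - x^d) E_{n,d} ≡ 0 (mod xⁿ - 1)`. [cite: CaroccaLangeRodriguez2019, §3 (proof of Thm. 3.1), p0005] -/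
theorem X_pow_sub_one_dvd_one_sub_X_pow_mul_cycIdem (hn : 0 < n) (d : ℕ) :
    X ^ n - 1 ∣ (1 - X ^ d) * cycIdem n d := by
  have h := X_pow_sub_one_dvd_roanPoly_mul_cycIdem hn (List.mem_singleton_self d)
  rwa [roanPoly_eq_prod, List.map_singleton, List.prod_singleton] at h

/-- `Φ_d ∣ P Q - 1` if `Φ_d ∣ P - 1` and `Φ_d ∣ Q - 1`. [folklore] -/
private theorem dvd_mul_sub_one₉ {Φ P Q : ℚ[X]} (hP : Φ ∣ P - 1) (hQ : Φ ∣ Q - 1) : Φ ∣ P * Q - 1 := by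
  have h : P * Q - 1 = (P - 1) * Q + (Q - 1) := by ring
  rw [h]
  exact dvd_add (dvd_mul_of_dvd_left hP Q) hQ

/-- **`R_l` is invertible modulo `Φ_d` when `d ∤ m` for all `m ∈ l`**: there is `a` with `Φ_d ∣ R_l a - 1`.
[cite: CaroccaLangeRodriguez2019, §3 (proof of Thm. 3.1), p0005] -/
theorem exists_cyclotomic_dvd_roanPoly_mul_sub_one {d : ℕ} {l : List ℕ} (hl : ∀ m ∈ l, 0 < m ∧ ¬d ∣ m) :
    ∃ a : ℚ[X], cyclotomic d ℚ ∣ roanPoly l * a - 1 := by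
  induction l with
  | nil => exact ⟨1, by simp⟩
  | cons m l ih =>
    obtain ⟨a, ha⟩ := ih fun m' hm' ↦ hl m' (List.mem_cons_of_mem m hm')
    obtain ⟨c, b, hcb⟩ := isCoprime_cyclotomic_one_sub_X_pow (hl m List.mem_cons_self).1 (hl m List.mem_cons_self).2
    refine ⟨b * a, ?_⟩
    have hb : cyclotomic d ℚ ∣ (1 - X ^ m) * b - 1 := ⟨-c, by linear_combination hcb⟩
    have h : roanPoly (m :: l) * (b * a) - 1 = ((1 - X ^ m) * b) * (roanPoly l * a) - 1 := by
      rw [roanPoly_cons]; ring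
    rw [h]
    exact dvd_mul_sub_one₉ hb ha

/-- **`E_{n,d} ≡ R_l Q (mod xⁿ - 1)` for some `Q`, when `d ∤ m` for all `m ∈ l`** — `Im e_d ⊂ Im R_l(α) = Y`.
[cite: CaroccaLangeRodriguez2019, §3 Thm. 3.1 (i) (`A_{W_{j_i}} = B_{d_i}`), p0005] -/
theorem exists_X_pow_sub_one_dvd_roanPoly_mul_sub_cycIdem (hn : 0 < n) {d : ℕ} {l : List ℕ}
    (hl : ∀ m ∈ l, 0 < m ∧ ¬d ∣ m) : ∃ Q : ℚ[X], X ^ n - 1 ∣ roanPoly l * Q - cycIdem n d := by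
  obtain ⟨a, ha⟩ := exists_cyclotomic_dvd_roanPoly_mul_sub_one hl
  refine ⟨a * cycIdem n d, X_pow_sub_one_dvd_sub_cycIdem hn ?_ fun m hm hmd ↦ ?_⟩
  · rw [← mul_assoc]
    exact dvd_mul_sub_one₉ ha (cyclotomic_dvd_cycIdem_sub_one n d)
  · rw [← mul_assoc]
    exact dvd_mul_of_dvd_right (cyclotomic_dvd_cycIdem hm hmd) _

/-- **`E_{n,m} ≡ E_{n,m} b (1 - x^d) (mod xⁿ - 1)` for some `b`, when `m ∤ d`**: `1 - α^d` is injective on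
`Im e_m`. [cite: CaroccaLangeRodriguez2019, §3 (proof of Thm. 3.1), p0005] -/
theorem exists_X_pow_sub_one_dvd_cycIdem_mul_one_sub_X_pow_sub (hn : 0 < n) {m d : ℕ} (hd : 0 < d) (hmd : ¬m ∣ d) :
    ∃ b : ℚ[X], X ^ n - 1 ∣ cycIdem n m * b * (1 - X ^ d) - cycIdem n m := by
  obtain ⟨c, b, hcb⟩ := isCoprime_cyclotomic_one_sub_X_pow hd hmd
  have hb : cyclotomic m ℚ ∣ b * (1 - X ^ d) - 1 := ⟨-c, by linear_combination hcb⟩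
  refine ⟨b, X_pow_sub_one_dvd_sub_cycIdem hn ?_ fun m' hm' hm'm ↦ ?_⟩
  · rw [mul_assoc]
    exact dvd_mul_sub_one₉ (cyclotomic_dvd_cycIdem_sub_one n m) hb
  · rw [mul_assoc]
    exact dvd_mul_of_dvd_left (cyclotomic_dvd_cycIdem hm' hm'm) _

end CyclotomicIdempotents

namespace ComplexTorus

open CyclotomicIdempotents

/-! ### §2 Roan's filtration `Y` and the parts `B`, as printed (real points), for any rational matrix `U` -/

section Filtration

variable {ι : Type*} [Fintype ι] [DecidableEq ι]

omit [DecidableEq ι] in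
/-- `(A B) ⊗ ℝ = (A ⊗ ℝ)(B ⊗ ℝ)`. [folklore] -/
private theorem map_ratCast_mul₉ (A B : Matrix ι ι ℚ) :
    (A * B).map (Rat.cast : ℚ → ℝ) = A.map (Rat.cast : ℚ → ℝ) * B.map (Rat.cast : ℚ → ℝ) :=
  Matrix.map_mul (f := Rat.castHom ℝ)

omit [Fintype ι] [DecidableEq ι] in
/-- `(Σ_i A_i) ⊗ ℝ = Σ_i (A_i ⊗ ℝ)`. [folklore] -/
private theorem map_ratCast_sum₉ {α : Type*} (s : Finset α) (A : α → Matrix ι ι ℚ) :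
    (∑ i ∈ s, A i).map (Rat.cast : ℚ → ℝ) = ∑ i ∈ s, (A i).map (Rat.cast : ℚ → ℝ) :=
  map_sum ((Rat.castHom ℝ : ℚ →+* ℝ).toAddMonoidHom.mapMatrix : Matrix ι ι ℚ →+ Matrix ι ι ℝ) A s

/-- **Roan's filtration, as printed**: for a list `l = [d_1, …, d_k]`, `Y_l ⊆ Λ ⊗ ℝ` is defined recursively by
`Y_{[]} := Λ ⊗ ℝ` (`= A`) and `Y_{l ++ [d]} := Im((1 - U^d)|Y_l) = (1 - U^d)(Y_l)` ("`Y_{d_0} := A` and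
`Y_{d_i} := Im(1_A - α^{d_i})|Y_{d_{i-1}}` for `i ≥ 1`, where `|` means restricted"), for any rational matrix
`U` (the rational representation of the automorphism `α`). [cite: CaroccaLangeRodriguez2019, §2.2 (e2.2), p0004] -/
def roanY (U : Matrix ι ι ℚ) (l : List ℕ) : Submodule ℝ (ι → ℝ) :=
  l.foldl (fun Y m ↦ Y.map ((1 - U ^ m).map (Rat.cast : ℚ → ℝ)).mulVecLin) ⊤

/-- **Roan's parts, as printed (real points of the identity component)**:
`B_{l,d} := Ker((1 - U^d)|Y_l) = Ker(1 - U^d) ∩ Y_l` ("`B_{d_i} := ker((1_A - α^{d_i})|Y_{d_{i-1}})_0` … the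
connected component `Fix(α^{d_i}|Y_{d_{i-1}})_0` containing `0`"); Roan's `B_{d_i}` is `roanB U [d_1,…,d_{i-1}] d_i`.
[cite: CaroccaLangeRodriguez2019, §2.2, p0004] -/
def roanB (U : Matrix ι ι ℚ) (l : List ℕ) (d : ℕ) : Submodule ℝ (ι → ℝ) :=
  LinearMap.ker ((1 - U ^ d).map (Rat.cast : ℚ → ℝ)).mulVecLin ⊓ roanY U l

/-- `Y_{[]} = A`. [cite: CaroccaLangeRodriguez2019, §2.2 (`Y_{d_0} := A`), p0004] -/
theorem roanY_nil (U : Matrix ι ι ℚ) : roanY U [] = ⊤ := rfl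

/-- The recursion `Y_{l ++ [d]} = (1 - U^d)(Y_l)`. [cite: CaroccaLangeRodriguez2019, §2.2 (`Y_{d_i} := Im(1_A - α^{d_i})|Y_{d_{i-1}}`), p0004] -/
theorem roanY_append_singleton (U : Matrix ι ι ℚ) (l : List ℕ) (m : ℕ) :
    roanY U (l ++ [m]) = (roanY U l).map ((1 - U ^ m).map (Rat.cast : ℚ → ℝ)).mulVecLin := by
  rw [roanY, roanY, List.foldl_append, List.foldl_cons, List.foldl_nil]

/-- Membership in `B_{l,d}`: `U^d v = v` and `v ∈ Y_l` ("the fixed group of the automorphism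
`α^{d_i}|Y_{d_{i-1}}`"). [cite: CaroccaLangeRodriguez2019, §2.2, p0004] -/
theorem mem_roanB_iff {U : Matrix ι ι ℚ} {l : List ℕ} {d : ℕ} {v : ι → ℝ} :
    v ∈ roanB U l d ↔ (U ^ d).map (Rat.cast : ℚ → ℝ) *ᵥ v = v ∧ v ∈ roanY U l := by
  rw [roanB, Submodule.mem_inf, LinearMap.mem_ker, Matrix.mulVecLin_apply,
    Matrix.map_sub (Rat.cast : ℚ → ℝ) Rat.cast_sub, Matrix.map_one Rat.cast Rat.cast_zero Rat.cast_one,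
    Matrix.sub_mulVec, Matrix.one_mulVec, sub_eq_zero, eq_comm]

omit [DecidableEq ι] in
/-- The image of `X^B = Im(B ⊗ ℝ)` under `C ⊗ ℝ` is `Im(CB ⊗ ℝ)`. [folklore] -/
private theorem map_mulVecLin_idemSubspace (C B : Matrix ι ι ℚ) :
    (idemSubspace B).map (C.map (Rat.cast : ℚ → ℝ)).mulVecLin = idemSubspace (C * B) := by
  rw [idemSubspace, idemSubspace, ← LinearMap.range_comp, ← Matrix.mulVecLin_mul, ← map_ratCast_mul₉]

omit [DecidableEq ι] in
/-- `Im(AB ⊗ ℝ) ⊆ Im(A ⊗ ℝ)`. [folklore] -/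
private theorem idemSubspace_mul_le (A B : Matrix ι ι ℚ) : idemSubspace (A * B) ≤ idemSubspace A := by
  rintro x hx
  obtain ⟨z, rfl⟩ := mem_idemSubspace_iff.1 hx
  exact mem_idemSubspace_iff.2 ⟨B.map (Rat.cast : ℚ → ℝ) *ᵥ z, by rw [Matrix.mulVec_mulVec, ← map_ratCast_mul₉]⟩

/-- **`Y_l = Im R_l(U)`, `R_l(U) = (1 - U^{d_k}) ⋯ (1 - U^{d_1})`** — the filtration is by images of
polynomials in `U`. [cite: CaroccaLangeRodriguez2019, §2.2, p0004] -/
theorem roanY_eq_idemSubspace_foldl (U : Matrix ι ι ℚ) (l : List ℕ) :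
    roanY U l = idemSubspace (l.foldl (fun M m ↦ (1 - U ^ m) * M) 1) := by
  induction l using List.reverseRecOn with
  | nil => rw [roanY_nil, List.foldl_nil, idemSubspace_one]
  | append_singleton l m ih =>
    rw [roanY_append_singleton, ih, map_mulVecLin_idemSubspace, List.foldl_append, List.foldl_cons,
      List.foldl_nil]

/-- The filtration is decreasing: `Y_{l ++ [m]} ⊆ Y_l` ("`0 = Y_{d_s} ⊂ Y_{d_{s-1}} ⊂ ⋯ ⊂ Y_{d_1} ⊂ Y_{d_0} = A`").
[cite: CaroccaLangeRodriguez2019, §2.2 (e2.2), p0004] -/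
theorem roanY_append_singleton_le (U : Matrix ι ι ℚ) (l : List ℕ) (m : ℕ) : roanY U (l ++ [m]) ≤ roanY U l := by
  -- `R_{l ++ [m]}(U) = (1 - U^m) R_l(U) = R_l(U) (1 - U^m)` (polynomials in `U` commute)
  have hcomm : ∀ l' : List ℕ, Commute (1 - U ^ m) (l'.foldl (fun M m ↦ (1 - U ^ m) * M) 1) := by
    intro l'
    induction l' using List.reverseRecOn with
    | nil => rw [List.foldl_nil]; exact Commute.one_right _
    | append_singleton l' m' ih =>
      rw [List.foldl_append, List.foldl_cons, List.foldl_nil]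
      exact ((Commute.one_right _).sub_right
        ((Commute.one_left _).sub_left ((Commute.refl U).pow_pow m m'))).mul_right ih
  rw [roanY_eq_idemSubspace_foldl, roanY_eq_idemSubspace_foldl, List.foldl_append, List.foldl_cons,
    List.foldl_nil, (hcomm l).eq]
  exact idemSubspace_mul_le _ _

/-- `U` preserves `Y_l` (the `Y_{d_i}` are "`G`-stable"). [cite: CaroccaLangeRodriguez2019, §2.2 ("a filtration of `A` into `G`-stable abelian subvarieties"), p0004] -/
theorem mulVec_mem_roanY {U : Matrix ι ι ℚ} {l : List ℕ} {v : ι → ℝ} (hv : v ∈ roanY U l) :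
    U.map (Rat.cast : ℚ → ℝ) *ᵥ v ∈ roanY U l := by
  have hcomm : ∀ l' : List ℕ, Commute U (l'.foldl (fun M m ↦ (1 - U ^ m) * M) 1) := by
    intro l'
    induction l' using List.reverseRecOn with
    | nil => rw [List.foldl_nil]; exact Commute.one_right _
    | append_singleton l' m' ih =>
      rw [List.foldl_append, List.foldl_cons, List.foldl_nil]
      exact ((Commute.one_right _).sub_right (Commute.self_pow U m')).mul_right ih
  rw [roanY_eq_idemSubspace_foldl] at hv ⊢
  exact mulVec_mem_idemSubspace_of_commute (hcomm l).eq.symm hv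

/-- `U` preserves `B_{l,d}` (the `B_{d_i}` are "`G`-stable abelian subvarieties").
[cite: CaroccaLangeRodriguez2019, §2.2, p0004] -/
theorem mulVec_mem_roanB {U : Matrix ι ι ℚ} {l : List ℕ} {d : ℕ} {v : ι → ℝ} (hv : v ∈ roanB U l d) :
    U.map (Rat.cast : ℚ → ℝ) *ᵥ v ∈ roanB U l d := by
  rw [mem_roanB_iff] at hv ⊢
  refine ⟨?_, mulVec_mem_roanY hv.2⟩
  rw [Matrix.mulVec_mulVec, ← map_ratCast_mul₉, ← pow_succ, pow_succ', map_ratCast_mul₉, ← Matrix.mulVec_mulVec,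
    hv.1]

end Filtration

/-! ### §3 Theorem 3.1 (i) / Roan's theorem: `B_{d_i} = X^{e_{d_i}}` and `Y_{d_s} = 0` when `d_1 < ⋯ < d_s`
are the orders of the eigenvalues of `u`; hence `B_{d_1} × ⋯ × B_{d_s} → X` is an isogeny -/

section RoanTheorem

variable {ι : Type*} [Fintype ι] [DecidableEq ι] {E : Type*} [NormedAddCommGroup E] [NormedSpace ℂ E]
  {Φ : (ι → ℝ) ≃L[ℝ] E} {n : ℕ} {u : endAlgRat Φ}

/-- `R_l(u)` as a matrix is the left fold `(1 - U^{d_k}) ⋯ (1 - U^{d_1})`. [cite: CaroccaLangeRodriguez2019, §2.2, p0004] -/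
theorem coe_aeval_roanPoly (u : endAlgRat Φ) (l : List ℕ) :
    ((aeval u (roanPoly l) : endAlgRat Φ) : Matrix ι ι ℚ) =
      l.foldl (fun M m ↦ (1 - (u : Matrix ι ι ℚ) ^ m) * M) 1 := by
  induction l using List.reverseRecOn with
  | nil => rw [roanPoly, List.foldl_nil, List.foldl_nil, map_one, Subalgebra.coe_one]
  | append_singleton l m ih =>
    rw [roanPoly_append_singleton, map_mul, Subalgebra.coe_mul, ih, List.foldl_append, List.foldl_cons,
      List.foldl_nil, map_sub, map_one, map_pow, aeval_X, Subalgebra.coe_sub, Subalgebra.coe_one, Subalgebra.coe_pow]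

/-- **`Y_l = X^{R_l(u)}`**: Roan's `Y` is the image of the endomorphism `R_l(u) = ∏_{m ∈ l} (1 - u^m) ∈ End_ℚ(X)`.
[cite: CaroccaLangeRodriguez2019, §2.2, p0004] -/
theorem roanY_eq_idemSubspace (u : endAlgRat Φ) (l : List ℕ) :
    roanY (u : Matrix ι ι ℚ) l = idemSubspace ((aeval u (roanPoly l) : endAlgRat Φ) : Matrix ι ι ℚ) := by
  rw [roanY_eq_idemSubspace_foldl, coe_aeval_roanPoly]

/-- **`X^{e_d} ⊆ Ker(1 - u^d)`**: `u^d = 1` on the `Φ_d`-component. [cite: CaroccaLangeRodriguez2019, §3 (proof of Thm. 3.1: "`α_i := α|B_{d_i}` is an automorphism of order `d_i`"), p0004–p0005] -/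
theorem idemSubspace_cyclicIdempotent_le_ker (hn : 0 < n) (hu : u ^ n = 1) (d : ℕ) :
    idemSubspace ((cyclicIdempotent n u d : endAlgRat Φ) : Matrix ι ι ℚ) ≤
      LinearMap.ker ((1 - (u : Matrix ι ι ℚ) ^ d).map (Rat.cast : ℚ → ℝ)).mulVecLin := by
  intro v hv
  obtain ⟨z, rfl⟩ := mem_idemSubspace_iff.1 hv
  have h0 : aeval u ((1 - X ^ d) * cycIdem n d) = 0 :=
    aeval_eq_zero_of_dvd hu (X_pow_sub_one_dvd_one_sub_X_pow_mul_cycIdem hn d)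
  rw [map_mul, map_sub, map_one, map_pow, aeval_X] at h0
  have h0' : (1 - (u : Matrix ι ι ℚ) ^ d) * ((cyclicIdempotent n u d : endAlgRat Φ) : Matrix ι ι ℚ) = 0 := by
    have := congrArg (fun a : endAlgRat Φ ↦ (a : Matrix ι ι ℚ)) h0
    simpa only [Subalgebra.coe_mul, Subalgebra.coe_sub, Subalgebra.coe_one, Subalgebra.coe_pow,
      Subalgebra.coe_zero, cyclicIdempotent] using this
  rw [LinearMap.mem_ker, Matrix.mulVecLin_apply, Matrix.mulVec_mulVec, ← map_ratCast_mul₉, h0',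
    Matrix.map_zero Rat.cast Rat.cast_zero, Matrix.zero_mulVec]

/-- **`X^{e_d} ⊆ Y_l` when `d ∤ m` for all `m ∈ l`**: each `1 - u^m` is invertible on the `Φ_d`-component
(`Φ_d` is prime to `1 - x^m`), so `e_d = R_l(u) Q(u)`. [cite: CaroccaLangeRodriguez2019, §3 Thm. 3.1 (i), p0005] -/
theorem idemSubspace_cyclicIdempotent_le_roanY (hn : 0 < n) (hu : u ^ n = 1) {d : ℕ} {l : List ℕ}
    (hl : ∀ m ∈ l, 0 < m ∧ ¬d ∣ m) :
    idemSubspace ((cyclicIdempotent n u d : endAlgRat Φ) : Matrix ι ι ℚ) ≤ roanY (u : Matrix ι ι ℚ) l := by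
  obtain ⟨Q, hQ⟩ := exists_X_pow_sub_one_dvd_roanPoly_mul_sub_cycIdem hn hl
  have h : cyclicIdempotent n u d = aeval u (roanPoly l) * aeval u Q := by
    rw [cyclicIdempotent, ← map_mul]; exact (aeval_eq_of_dvd_sub hu hQ).symm
  rw [roanY_eq_idemSubspace, h, Subalgebra.coe_mul]
  exact idemSubspace_mul_le _ _

/-- Decomposing a vector along the cyclotomic idempotents: `v = Σ_{m ∣ n} e_m(u) v`. [cite: LangeRodriguez2022, §2.8 (2.22) (`1 = Σ e_{W_j}`), p0040] -/
theorem sum_cyclicIdempotent_mulVec (hn : 0 < n) (hu : u ^ n = 1) (v : ι → ℝ) :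
    ∑ m ∈ n.divisors, ((cyclicIdempotent n u m : endAlgRat Φ) : Matrix ι ι ℚ).map (Rat.cast : ℚ → ℝ) *ᵥ v = v := by
  rw [← Matrix.sum_mulVec, ← map_ratCast_sum₉, ← AddSubmonoidClass.coe_finsetSum, sum_cyclicIdempotent hn hu,
    Subalgebra.coe_one, Matrix.map_one Rat.cast Rat.cast_zero Rat.cast_one, Matrix.one_mulVec]

/-- `e_m(u)` kills `Ker(1 - u^d)` when `m ∤ d` (`1 - u^d` is injective on the `Φ_m`-component).
[cite: CaroccaLangeRodriguez2019, §3 (proof of Thm. 3.1 and Lemma 3.2), p0005] -/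
theorem cyclicIdempotent_mulVec_eq_zero_of_not_dvd (hn : 0 < n) (hu : u ^ n = 1) {m d : ℕ} (hd : 0 < d)
    (hmd : ¬m ∣ d) {v : ι → ℝ} (hv : v ∈ LinearMap.ker ((1 - (u : Matrix ι ι ℚ) ^ d).map (Rat.cast : ℚ → ℝ)).mulVecLin) :
    ((cyclicIdempotent n u m : endAlgRat Φ) : Matrix ι ι ℚ).map (Rat.cast : ℚ → ℝ) *ᵥ v = 0 := by
  obtain ⟨b, hb⟩ := exists_X_pow_sub_one_dvd_cycIdem_mul_one_sub_X_pow_sub hn hd hmd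
  have h : cyclicIdempotent n u m = cyclicIdempotent n u m * aeval u b * (1 - u ^ d) := by
    have := aeval_eq_of_dvd_sub hu hb
    rw [map_mul, map_mul, map_sub, map_one, map_pow, aeval_X] at this
    exact this.symm
  rw [LinearMap.mem_ker, Matrix.mulVecLin_apply] at hv
  rw [h, Subalgebra.coe_mul, Subalgebra.coe_sub, Subalgebra.coe_one, Subalgebra.coe_pow, map_ratCast_mul₉,
    ← Matrix.mulVec_mulVec, hv, Matrix.mulVec_zero]

/-- `e_m(u)` kills `Y_l` when `m ∈ l` (the factor `1 - u^m` of `R_l(u)` annihilates the `Φ_m`-component).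
[cite: CaroccaLangeRodriguez2019, §3 (proof of Thm. 3.1), p0005] -/
theorem cyclicIdempotent_mulVec_eq_zero_of_mem (hn : 0 < n) (hu : u ^ n = 1) {m : ℕ} {l : List ℕ} (hm : m ∈ l)
    {v : ι → ℝ} (hv : v ∈ roanY (u : Matrix ι ι ℚ) l) :
    ((cyclicIdempotent n u m : endAlgRat Φ) : Matrix ι ι ℚ).map (Rat.cast : ℚ → ℝ) *ᵥ v = 0 := by
  rw [roanY_eq_idemSubspace] at hv
  obtain ⟨w, rfl⟩ := mem_idemSubspace_iff.1 hv
  have h0 : cyclicIdempotent n u m * aeval u (roanPoly l) = 0 := by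
    rw [cyclicIdempotent, ← map_mul, mul_comm]
    exact aeval_eq_zero_of_dvd hu (X_pow_sub_one_dvd_roanPoly_mul_cycIdem hn hm)
  rw [Matrix.mulVec_mulVec, ← map_ratCast_mul₉, ← Subalgebra.coe_mul, h0, Subalgebra.coe_zero,
    Matrix.map_zero Rat.cast Rat.cast_zero, Matrix.zero_mulVec]

/-- **THEOREM 3.1 (i) with Roan's definition: `B_{l,d} = X^{e_d(u)}`** — `Ker(1 - u^d) ∩ Y_l` is exactly the
image of the cyclotomic idempotent `e_d(u)` (the isotypical component `A_{W_d}`), provided every `m ∈ l` is a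
positive integer with `d ∤ m` and every proper divisor `m` of `d` whose component `X^{e_m}` is non-zero (i.e.
every eigenvalue order `m ∣ d`, `m ≠ d`) occurs in `l` — as is the case for Roan's lists `l = [d_1,…,d_{i-1}]`,
`d = d_i`, `d_1 < ⋯ < d_s` the eigenvalue orders. [cite: CaroccaLangeRodriguez2019, §3 Thm. 3.1 (i) ("`A_{W_{j_i}} = B_{d_i}`"), p0005] -/
theorem roanB_eq_idemSubspace_cyclicIdempotent (hn : 0 < n) (hu : u ^ n = 1) {d : ℕ} (hd : 0 < d) {l : List ℕ}
    (hl : ∀ m ∈ l, 0 < m ∧ ¬d ∣ m)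
    (hcomplete : ∀ m ∈ n.divisors, m ∣ d → m ≠ d → cyclicIdempotent n u m ≠ 0 → m ∈ l) :
    roanB (u : Matrix ι ι ℚ) l d = idemSubspace ((cyclicIdempotent n u d : endAlgRat Φ) : Matrix ι ι ℚ) := by
  refine le_antisymm ?_ (le_inf (idemSubspace_cyclicIdempotent_le_ker hn hu d)
    (idemSubspace_cyclicIdempotent_le_roanY hn hu hl))
  rintro v ⟨hker, hY⟩
  -- `v = Σ_m e_m v` and every term with `m ≠ d` vanishes
  have hterm : ∀ m ∈ n.divisors, m ≠ d →
      ((cyclicIdempotent n u m : endAlgRat Φ) : Matrix ι ι ℚ).map (Rat.cast : ℚ → ℝ) *ᵥ v = 0 := by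
    intro m hm hmd
    by_cases hdvd : m ∣ d
    · by_cases h0 : cyclicIdempotent n u m = 0
      · rw [h0, Subalgebra.coe_zero, Matrix.map_zero Rat.cast Rat.cast_zero, Matrix.zero_mulVec]
      · exact cyclicIdempotent_mulVec_eq_zero_of_mem hn hu (hcomplete m hm hdvd hmd h0) hY
    · exact cyclicIdempotent_mulVec_eq_zero_of_not_dvd hn hu hd hdvd hker
  have hv : ((cyclicIdempotent n u d : endAlgRat Φ) : Matrix ι ι ℚ).map (Rat.cast : ℚ → ℝ) *ᵥ v = v := by
    by_cases hdn : d ∈ n.divisors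
    · conv_rhs => rw [← sum_cyclicIdempotent_mulVec hn hu v, ← Finset.add_sum_erase _ _ hdn]
      rw [Finset.sum_eq_zero fun m hm ↦ hterm m (Finset.mem_of_mem_erase hm) (Finset.ne_of_mem_erase hm), add_zero]
    · -- `d ∤ n`: then `e_d = 0` and also `v = Σ_{m ∣ n} e_m v = 0`
      have hv0 : v = 0 := by
        rw [← sum_cyclicIdempotent_mulVec hn hu v]
        exact Finset.sum_eq_zero fun m hm ↦ hterm m hm (fun h ↦ hdn (h ▸ hm))
      rw [hv0, Matrix.mulVec_zero]
  exact mem_idemSubspace_iff.2 ⟨v, hv⟩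

end RoanTheorem

/-! ### §4 Roan's theorem for the list of eigenvalue orders `d_1 < ⋯ < d_s` -/

section EigenvalueOrders

variable {ι : Type*} [Fintype ι] [DecidableEq ι] {E : Type*} [NormedAddCommGroup E] [NormedSpace ℂ E]
  {Φ : (ι → ℝ) ≃L[ℝ] E} {n : ℕ} {u : endAlgRat Φ}

/-- `X^A = 0 ⟺ A = 0` for a rational matrix `A`. [folklore] -/
private theorem idemSubspace_eq_bot_iff {A : Matrix ι ι ℚ} : idemSubspace A = ⊥ ↔ A = 0 := by
  constructor
  · intro h
    rw [idemSubspace, LinearMap.range_eq_bot] at h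
    have hA : A.map (Rat.cast : ℚ → ℝ) = 0 := by
      ext i j
      have := congrArg (fun f : (ι → ℝ) →ₗ[ℝ] (ι → ℝ) ↦ f (Pi.single j 1) i) h
      simpa [Matrix.mulVecLin_apply, Matrix.mulVec_single_one] using this
    ext i j
    have hij := congrArg (fun M : Matrix ι ι ℝ ↦ M i j) hA
    simpa [Matrix.map_apply] using hij
  · rintro rfl
    exact idemSubspace_zero

variable (n u) in
/-- **The orders of the eigenvalues of `u`** (`uⁿ = 1`): the divisors `d ∣ n` whose cyclotomic component
`X^{e_d(u)}` is non-zero — equivalently (`ComplexTorusCyclicGroupAction`: `charpoly(u|X^{e_d}) = Φ_d^{h_d}`,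
`Σ_d rk Λ(X^{e_d}) = rk Λ`) the `d` such that a primitive `d`-th root of unity is an eigenvalue of the rational
(or analytic) representation of `u` ("`1 ≤ d_1 < d_2 < ⋯ < d_s` are the orders of the eigenvalues of `α`,
meaning the eigenvalues of the analytic representation `ρ_a(α)`").
[cite: CaroccaLangeRodriguez2019, §2.2, p0004] -/
def eigenvalueOrders : Finset ℕ := n.divisors.filter fun d ↦ cyclicIdempotent n u d ≠ 0

/-- Membership in `eigenvalueOrders`. [cite: CaroccaLangeRodriguez2019, §2.2, p0004] -/
theorem mem_eigenvalueOrders {d : ℕ} : d ∈ eigenvalueOrders n u ↔ d ∈ n.divisors ∧ cyclicIdempotent n u d ≠ 0 :=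
  Finset.mem_filter

/-- `d` is an eigenvalue order iff the component `X^{e_d(u)}` is non-zero ("all subvarieties `B_{d_i}` are of
positive dimension"). [cite: CaroccaLangeRodriguez2019, §2.2 ("Note that all subvarieties `B_{d_i}` are of positive dimension"), p0004] -/
theorem mem_eigenvalueOrders_iff_ne_bot (hn : 0 < n) (hu : u ^ n = 1) {d : ℕ} :
    d ∈ eigenvalueOrders n u ↔ idemSubspace ((cyclicIdempotent n u d : endAlgRat Φ) : Matrix ι ι ℚ) ≠ ⊥ := by
  simp only [mem_eigenvalueOrders, ne_eq]
  rw [idemSubspace_eq_bot_iff, ZeroMemClass.coe_eq_zero]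
  constructor
  · exact fun h ↦ h.2
  · intro h
    refine ⟨?_, h⟩
    by_contra hd
    exact h (cyclicIdempotent_of_not_mem_divisors hn hu hd)

variable (n u) in
/-- **Roan's list `d_1 < d_2 < ⋯ < d_s` of the eigenvalue orders**, in increasing order.
[cite: CaroccaLangeRodriguez2019, §2.2 ("Suppose `1 ≤ d_1 < d_2 < ⋯ < d_s` are the orders of the eigenvalues of `α`"), p0004] -/
def roanList : List ℕ := (eigenvalueOrders n u).sort

/-- Membership in Roan's list. [cite: CaroccaLangeRodriguez2019, §2.2, p0004] -/
theorem mem_roanList {d : ℕ} : d ∈ roanList n u ↔ d ∈ n.divisors ∧ cyclicIdempotent n u d ≠ 0 := by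
  rw [roanList, Finset.mem_sort, mem_eigenvalueOrders]

/-- Roan's list is strictly increasing. [cite: CaroccaLangeRodriguez2019, §2.2, p0004] -/
theorem roanList_pairwise_lt : (roanList n u).Pairwise (· < ·) :=
  (Finset.sortedLT_sort _).pairwise

/-- **THEOREM 3.1 (i) for Roan's list: `B_d := Ker(1 - u^d) ∩ Y_{[d_j : d_j < d]} = X^{e_d(u)}` for every
`d ≥ 1`** — for `d = d_i` an eigenvalue order this is Roan's `B_{d_i} = A_{W_{d_i}}`; for other `d` both sides
vanish (Theorem 3.1 (ii)). [cite: CaroccaLangeRodriguez2019, §3 Thm. 3.1 (i)–(ii), p0005] -/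
theorem roanB_roanList_filter_eq (hn : 0 < n) (hu : u ^ n = 1) {d : ℕ} (hd : 0 < d) :
    roanB (u : Matrix ι ι ℚ) ((roanList n u).filter (· < d)) d =
      idemSubspace ((cyclicIdempotent n u d : endAlgRat Φ) : Matrix ι ι ℚ) := by
  refine roanB_eq_idemSubspace_cyclicIdempotent hn hu hd (fun m hm ↦ ?_) (fun m hm hmd hne h0 ↦ ?_)
  · rw [List.mem_filter, mem_roanList, decide_eq_true_eq] at hm
    refine ⟨Nat.pos_of_mem_divisors hm.1.1, fun hdm ↦ ?_⟩
    exact absurd (Nat.le_of_dvd (Nat.pos_of_mem_divisors hm.1.1) hdm) (not_le.2 hm.2)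
  · rw [List.mem_filter, mem_roanList, decide_eq_true_eq]
    exact ⟨⟨hm, h0⟩, lt_of_le_of_ne (Nat.le_of_dvd hd hmd) hne⟩

/-- For a strictly increasing list, the prefix before the `i`-th entry is the sub-list of entries `< l[i]`.
[folklore] -/
private theorem filter_lt_eq_take₉ : ∀ (l : List ℕ), l.Pairwise (· < ·) → ∀ (i : ℕ) (hi : i < l.length),
    l.filter (· < l[i]) = l.take i
  | [], _, i, hi => absurd hi (Nat.not_lt_zero _)
  | a :: l, hl, 0, _ => by
    rw [List.take_zero, List.filter_eq_nil_iff]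
    intro b hb
    rw [decide_eq_true_eq, List.getElem_cons_zero, not_lt]
    rcases List.mem_cons.1 hb with rfl | hb
    · exact le_rfl
    · exact le_of_lt ((List.pairwise_cons.1 hl).1 b hb)
  | a :: l, hl, i + 1, hi => by
    have hi' : i < l.length := by simpa using hi
    have ha : a < l[i] := (List.pairwise_cons.1 hl).1 _ (List.getElem_mem hi')
    rw [List.getElem_cons_succ, List.take_succ_cons, List.filter_cons_of_pos (by simpa using ha),
      filter_lt_eq_take₉ l (List.pairwise_cons.1 hl).2 i hi']

/-- **THEOREM 3.1 (i), indexed form: `B_{d_i} = Ker((1 - u^{d_i})|Y_{d_{i-1}}) = X^{e_{d_i}(u)}`** for Roan's list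
`[d_1, …, d_s] = roanList n u` and every `i` (`Y_{d_{i-1}}` built from the prefix `[d_1, …, d_{i-1}]`).
[cite: CaroccaLangeRodriguez2019, §2.2 and §3 Thm. 3.1 (i) ("`A_{W_{j_i}} = B_{d_i}`"), p0004–p0005] -/
theorem roanB_roanList_take_eq (hn : 0 < n) (hu : u ^ n = 1) (i : ℕ) (hi : i < (roanList n u).length) :
    roanB (u : Matrix ι ι ℚ) ((roanList n u).take i) (roanList n u)[i] =
      idemSubspace ((cyclicIdempotent n u (roanList n u)[i] : endAlgRat Φ) : Matrix ι ι ℚ) := by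
  have hd : (roanList n u)[i] ∈ roanList n u := List.getElem_mem hi
  rw [mem_roanList] at hd
  rw [← filter_lt_eq_take₉ _ roanList_pairwise_lt i hi]
  exact roanB_roanList_filter_eq hn hu (Nat.pos_of_mem_divisors hd.1)

/-- **`R_l(u) = 0` for the full list of eigenvalue orders**: `∏_i (1 - u^{d_i})` kills every component.
[cite: CaroccaLangeRodriguez2019, §2.2 (`0 = Y_{d_s}`), p0004] -/
theorem aeval_roanPoly_roanList (hn : 0 < n) (hu : u ^ n = 1) : aeval u (roanPoly (roanList n u)) = 0 := by
  rw [← mul_one (aeval u (roanPoly (roanList n u))), ← sum_cyclicIdempotent hn hu, Finset.mul_sum]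
  refine Finset.sum_eq_zero fun m hm ↦ ?_
  by_cases h0 : cyclicIdempotent n u m = 0
  · rw [h0, mul_zero]
  · rw [cyclicIdempotent, ← map_mul]
    exact aeval_eq_zero_of_dvd hu (X_pow_sub_one_dvd_roanPoly_mul_cycIdem hn (mem_roanList.2 ⟨hm, h0⟩))

/-- **`Y_{d_s} = 0`**: Roan's filtration ends at zero. [cite: CaroccaLangeRodriguez2019, §2.2 (e2.2: "`0 = Y_{d_s} ⊂ Y_{d_{s-1}} ⊂ ⋯ ⊂ Y_{d_0} = A`"), p0004] -/
theorem roanY_roanList_eq_bot (hn : 0 < n) (hu : u ^ n = 1) : roanY (u : Matrix ι ι ℚ) (roanList n u) = ⊥ := by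
  rw [roanY_eq_idemSubspace, aeval_roanPoly_roanList hn hu, Subalgebra.coe_zero, idemSubspace_zero]

/-- **All `B_{d_i}` are of positive dimension.** [cite: CaroccaLangeRodriguez2019, §2.2 ("Note that all subvarieties `B_{d_i}` are of positive dimension, whereas for the isotypical decomposition this need not be the case"), p0004] -/
theorem roanB_roanList_take_ne_bot (hn : 0 < n) (hu : u ^ n = 1) (i : ℕ) (hi : i < (roanList n u).length) :
    roanB (u : Matrix ι ι ℚ) ((roanList n u).take i) (roanList n u)[i] ≠ ⊥ := by
  rw [roanB_roanList_take_eq hn hu i hi, ← mem_eigenvalueOrders_iff_ne_bot hn hu, ← Finset.mem_sort (· ≤ ·)]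
  exact List.getElem_mem hi

/-- The cyclotomic idempotents of the eigenvalue orders are complete orthogonal idempotents (the others
vanish). [cite: CaroccaLangeRodriguez2019, §3 Thm. 3.1 (ii) ("for all components `A_{W_k}` with `k ≠ j_i` … `A_{W_k} = 0`"), p0005] -/
theorem completeOrthogonalIdempotents_eigenvalueOrders (hn : 0 < n) (hu : u ^ n = 1) :
    CompleteOrthogonalIdempotents fun d : eigenvalueOrders n u ↦ cyclicIdempotent n u d where
  idem d := isIdempotentElem_cyclicIdempotent hn hu d
  ortho d d' hne := cyclicIdempotent_mul_cyclicIdempotent hn hu fun h ↦ hne (Subtype.ext h)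
  complete := by
    rw [Finset.sum_coe_sort (eigenvalueOrders n u) (fun d ↦ cyclicIdempotent n u d), ← sum_cyclicIdempotent hn hu]
    refine Finset.sum_subset (Finset.filter_subset _ _) fun d hd hnot ↦ ?_
    rw [mem_eigenvalueOrders, not_and, not_ne_iff] at hnot
    exact hnot hd

variable (Φ) in
/-- **ROAN'S DECOMPOSITION THEOREM: the addition map `B_{d_1} × ⋯ × B_{d_s} → X` is an isogeny**, the `B_{d}`,
`d ∈ {d_1 < ⋯ < d_s}` the eigenvalue orders, being the complex sub-tori `X^{e_d(u)}` whose real subspaces are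
Roan's `Ker((1 - u^{d_i})|Y_{d_{i-1}})` (`roanB_roanList_take_eq`). [cite: CaroccaLangeRodriguez2019, §2.2 (e2.3) ("Roan's decomposition theorem says (see [lb]) that the addition map `B_{d_1} × ⋯ × B_{d_s} → A` is an isogeny") and §3 Thm. 3.1, p0004–p0005] -/
theorem isIsogeny_sum_roan (hn : 0 < n) (hu : u ^ n = 1) :
    IsIsogeny (sigmaPiPeriod fun d : eigenvalueOrders n u ↦ idemPeriod Φ (cyclicIdempotent n u d)) Φ
      (sumMatrix fun d : eigenvalueOrders n u ↦
        idemSubspace ((cyclicIdempotent n u d : endAlgRat Φ) : Matrix ι ι ℚ)) :=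
  isIsogeny_sum_idem Φ (completeOrthogonalIdempotents_eigenvalueOrders hn hu)

variable (Φ) in
/-- **`∏_{d eigenvalue order} B_d ∼ X`.** [cite: CaroccaLangeRodriguez2019, §2.2 (e2.3), p0004] -/
theorem isIsogenous_sigmaPi_roan (hn : 0 < n) (hu : u ^ n = 1) :
    IsIsogenous (sigmaPiPeriod fun d : eigenvalueOrders n u ↦ idemPeriod Φ (cyclicIdempotent n u d)) Φ :=
  ⟨_, isIsogeny_sum_roan Φ hn hu⟩

end EigenvalueOrders

/-! ### §5 Junction with the group-algebra idempotents of a cyclic group action (Theorem 3.1 as printed) -/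

section CyclicGroup

open Literature.RepresentationTheory.FiniteGroups

variable {G : Type*} [CommGroup G] [Fintype G]
variable {ι : Type*} [Fintype ι] [DecidableEq ι] {E : Type*} [NormedAddCommGroup E] [NormedSpace ℂ E]
  {Φ : (ι → ℝ) ≃L[ℝ] E} (ρ : G →* endAlgRat Φ)

/-- **THEOREM 3.1 (i) as printed, for a cyclic group `G = ⟨g⟩` of order `n` acting on `X`**: Roan's
`B_d = Ker((1 - ρ(g)^d)|Y)` (the filtration taken along the eigenvalue orders `< d` of `ρ(g)`) is the
isotypical component `A_{W_K} = X^{ρ̄ e_K}` of the subgroup `K = ⟨g^d⟩` with cyclic quotient of order `d`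
(`d ∣ n`). [cite: CaroccaLangeRodriguez2019, §3 Thm. 3.1 (i) ("For every `i = 1, …, s` there is exactly one `j_i` … such that `A_{W_{j_i}} = B_{d_i}`"), p0005] -/
theorem roanB_eq_idemSubspace_kernelIdempotent_zpowers_pow {g : G} (hg : ∀ x, x ∈ Subgroup.zpowers g) {d : ℕ}
    (hd : d ∣ Fintype.card G) (hd0 : 0 < d) :
    roanB ((ρ g : endAlgRat Φ) : Matrix ι ι ℚ) ((roanList (Fintype.card G) (ρ g)).filter (· < d)) d =
      idemSubspace ((groupAlgebraRep ρ (kernelIdempotent (Subgroup.zpowers (g ^ d))) : endAlgRat Φ) :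
        Matrix ι ι ℚ) := by
  rw [groupAlgebraRep_kernelIdempotent_zpowers_pow ρ hg hd]
  exact roanB_roanList_filter_eq Fintype.card_pos (by rw [← map_pow, pow_card_eq_one, map_one]) hd0

end CyclicGroup

/-! ### §6 Validation: the first step `B_1 = Fix(u) = X^{e_1}`, the second step `B_2 = Ker(1 - u²) ∩ Im(1 - u)
= X^{e_2}`, and involutions (`n = 2`: the symmetric / anti-symmetric pair of Q490, the swap of `X × X`, `u = -1`) -/

section Validation

variable {ι : Type*} [Fintype ι] [DecidableEq ι] {E : Type*} [NormedAddCommGroup E] [NormedSpace ℂ E]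
  {Φ : (ι → ℝ) ≃L[ℝ] E} {n : ℕ} {u : endAlgRat Φ}

/-- **Roan's first step: `B_1 = Ker(1 - u) ∩ A = Fix(u) = X^{e_1(u)}`** (for any `u` with `uⁿ = 1`; `d_1 = 1`
occurs iff `u` has the eigenvalue `1`). [cite: CaroccaLangeRodriguez2019, §2.2 (`Y_{d_0} := A`, `B_{d_1}`), p0004] -/
theorem roanB_nil_one (hn : 0 < n) (hu : u ^ n = 1) :
    roanB (u : Matrix ι ι ℚ) [] 1 = idemSubspace ((cyclicIdempotent n u 1 : endAlgRat Φ) : Matrix ι ι ℚ) :=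
  roanB_eq_idemSubspace_cyclicIdempotent hn hu one_pos (fun _ h ↦ absurd h List.not_mem_nil)
    fun _ _ hm1 hne _ ↦ absurd (Nat.dvd_one.1 hm1) hne

/-- **Roan's second step after `d_1 = 1`: `B_2 = Ker(1 - u²) ∩ Im(1 - u) = X^{e_2(u)}`** (for any `u` with
`uⁿ = 1`). [cite: CaroccaLangeRodriguez2019, §2.2 (`Y_{d_1} = Im(1 - α^{d_1})`, `B_{d_2}`), p0004] -/
theorem roanB_singleton_one_two (hn : 0 < n) (hu : u ^ n = 1) :
    roanB (u : Matrix ι ι ℚ) [1] 2 = idemSubspace ((cyclicIdempotent n u 2 : endAlgRat Φ) : Matrix ι ι ℚ) := by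
  refine roanB_eq_idemSubspace_cyclicIdempotent hn hu two_pos (fun m hm ↦ ?_) fun m _ hm2 hne _ ↦ ?_
  · rw [List.mem_singleton.1 hm]
    exact ⟨one_pos, by decide⟩
  · -- a proper divisor of `2` is `1`
    have hle : m ≤ 2 := Nat.le_of_dvd two_pos hm2
    have hm0 : m ≠ 0 := by rintro rfl; simp at hm2
    interval_cases m
    · exact absurd rfl hm0
    · exact List.mem_singleton_self 1
    · exact absurd rfl hne

/-- **Involutions (`σ² = 1`): Roan's `B_1 = Fix(σ) = X^{½(1 + σ)}`**, the symmetric part of Q490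
(`involutionIdempotent`). [cite: CaroccaLangeRodriguez2019, §2.2, p0004] -/
theorem roanB_nil_one_of_involution {σ : endAlgRat Φ} (hσ : σ * σ = 1) :
    roanB (σ : Matrix ι ι ℚ) [] 1 = idemSubspace ((involutionIdempotent Φ σ : endAlgRat Φ) : Matrix ι ι ℚ) := by
  rw [← cyclicIdempotent_two_one Φ hσ]
  exact roanB_nil_one two_pos (by rw [pow_two, hσ])

/-- **Involutions: Roan's `B_2 = Ker(1 - σ²) ∩ Im(1 - σ) = Im(1 - σ) = X^{½(1 - σ)}`**, the anti-symmetric part.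
[cite: CaroccaLangeRodriguez2019, §2.2, p0004] -/
theorem roanB_singleton_one_two_of_involution {σ : endAlgRat Φ} (hσ : σ * σ = 1) :
    roanB (σ : Matrix ι ι ℚ) [1] 2 = idemSubspace ((1 - involutionIdempotent Φ σ : endAlgRat Φ) : Matrix ι ι ℚ) := by
  rw [← cyclicIdempotent_two_two Φ hσ]
  exact roanB_singleton_one_two two_pos (by rw [pow_two, hσ])

/-- **`u = -1` (e.g. `-1_X` on any torus): the only eigenvalue order is `2`, `roanList = [2]`**, and Roan's
decomposition is the trivial one `B_2 = X`. [cite: CaroccaLangeRodriguez2019, §2.2, p0004] -/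
theorem roanList_neg_one [Nonempty ι] : roanList 2 (-1 : endAlgRat Φ) = [2] := by
  have h : eigenvalueOrders 2 (-1 : endAlgRat Φ) = {2} := by
    ext d
    rw [mem_eigenvalueOrders, Finset.mem_singleton]
    constructor
    · rintro ⟨hd, hne⟩
      have hd2 : d ∣ 2 := Nat.dvd_of_mem_divisors hd
      have hle : d ≤ 2 := Nat.le_of_dvd two_pos hd2
      have hd0 : d ≠ 0 := by rintro rfl; simp at hd2
      interval_cases d
      · exact absurd rfl hd0
      · exact absurd (cyclicIdempotent_two_neg_one_one Φ) hne
      · rfl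
    · rintro rfl
      refine ⟨by decide, ?_⟩
      rw [cyclicIdempotent_two_neg_one_two Φ]
      exact one_ne_zero
  rw [roanList, h, Finset.sort_singleton]

/-- For `u = -1`: `B_2 = Ker(1 - (-1)²) ∩ A = A`. [cite: CaroccaLangeRodriguez2019, §2.2, p0004] -/
theorem roanB_neg_one_two : roanB ((-1 : endAlgRat Φ) : Matrix ι ι ℚ) [] 2 = ⊤ := by
  have h := roanB_roanList_filter_eq (n := 2) (u := (-1 : endAlgRat Φ)) two_pos (by norm_num) two_pos
  rw [cyclicIdempotent_two_neg_one_two Φ, Subalgebra.coe_one, idemSubspace_one] at h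
  rw [← h]
  congr 1
  symm
  rw [List.filter_eq_nil_iff]
  intro d hd
  rw [mem_roanList] at hd
  have hd2 : d ∣ 2 := Nat.dvd_of_mem_divisors hd.1
  have hle : d ≤ 2 := Nat.le_of_dvd two_pos hd2
  have hd0 : d ≠ 0 := by rintro rfl; simp at hd2
  interval_cases d
  · exact absurd rfl hd0
  · exact absurd (cyclicIdempotent_two_neg_one_one Φ) hd.2
  · decide

/-- **The swap `(x, y) ↦ (y, x)` of `X × X`: `B_1 = Fix = ` the diagonal, `B_2 = Ker(1 - swap²) ∩ Im(1 - swap) = `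
the anti-diagonal** (Q490 / `ComplexTorusCyclicGroupAction` §6). [cite: CaroccaLangeRodriguez2019, §2.2, p0004] -/
theorem roanB_swapEnd_one :
    roanB ((swapEnd Φ : endAlgRat (prodPeriod Φ Φ)) : Matrix (ι ⊕ ι) (ι ⊕ ι) ℚ) [] 1 = graphFstSubspace 1 := by
  rw [roanB_nil_one (n := 2) two_pos (by rw [pow_two, swapEnd_mul_self]),
    idemSubspace_cyclicIdempotent_swapEnd_one]

/-- The swap of `X × X`: `B_2 = ` the anti-diagonal `{(x, -x)}`. [cite: CaroccaLangeRodriguez2019, §2.2, p0004] -/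
theorem roanB_swapEnd_two :
    roanB ((swapEnd Φ : endAlgRat (prodPeriod Φ Φ)) : Matrix (ι ⊕ ι) (ι ⊕ ι) ℚ) [1] 2 = graphSndSubspace (-1) := by
  rw [roanB_singleton_one_two (n := 2) two_pos (by rw [pow_two, swapEnd_mul_self]),
    idemSubspace_cyclicIdempotent_swapEnd_two]

end Validation

end ComplexTorus

end Literature.Geometry.Kaehler

end
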